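import Summits.AnomalousDissipation.AnomalousDissipation.Theses.TaylorCertificates
import Summits.AnomalousDissipation.AnomalousDissipation.Theorems.EnsembleCeiling.Negative.SingleModeFat
import Summits.AnomalousDissipation.AnomalousDissipation.Theorems.EnsembleCeiling.Negative.OrthogonalClassFat
import Summits.AnomalousDissipation.AnomalousDissipation.Theorems.EnsembleCeiling.Negative.DiracAtoms
import Summits.AnomalousDissipation.AnomalousDissipation.Theorems.EnsembleCeiling.Negative.BeltramiFat
import Summits.AnomalousDissipation.AnomalousDissipation.Theorems.EnsembleCeiling.Negative.CellularFat
import Literature.Analysis.FluidPDE.StatisticalSolutionEnergyEq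

/-!
# Line `sweep-test-cyclic-tlf-witness` for crux `TaylorCertificates.EnsembleCeiling`
# (stmt-AnomalousDissipation-14090) — CHECKED SKELETON (crux-plan, round 1)

Planner `planner-cruxplan-stmt-AnomalousDissipation-14090-sweep-test-cyclic-tl-0`, from the idea card
`Cruxes/EnsembleCeiling/Ideas/sweep-test-cyclic-tlf-witness.md` (crux-ideate r1 k1; triage r1: pass ×3)
and the disprover's `Cruxes/EnsembleCeiling/Disproof.lean` (rev 2: NO KILL; five landed Negative parts,
all imported above so that the witness is screened against them in this very file).

## The line

THE CRUX IS `∃ f`; THIS LINE NAMES THE WITNESS AND LOCALISES THE ENEMY. The witness is the DETUNED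
CYCLIC force `f₁₂₃ = (sin 2πx₃, sin 4πx₁, sin 6πx₂)` — three linearly polarised Stokes modes on the
shells `|k|² = 1, 4, 9`, each the UNSWEPT CROSSING partner of the next (sweep test: the laminar response
of a linearly polarised mode `a sin(2πk·x)` leaves the plane `{k'·a = 0}` unswept, and a partner mode
there whose polarisation has a component along `∇` of the shear is lifted up to streaks `~ν⁻³`, so no
laminar ray of `f₁₂₃` can anchor a fat state; two fat components tilt each other EXACTLY:
`u = (U(z − R(y)t), 0, R(y))` solves Euler). `f₁₂₃` is outside every dead force class of the Disproof
(not single-mode, `k₂·z₁ = −2i ≠ 0` so not in the orthogonal class, three shell radii so not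
single-shell / Beltrami / cellular — `screen_*` below), its Stokes state is not Euler-steady, and the
triage numerics (TRIAGE-r1-1 §N2: K = 4/5 Galerkin Newton + 32³ DNS, jobs j009652/j013457/j013464/
j009658) show its Stokes-connected steady branch SATURATING at `|u| ≈ 1 → 0.75` for `ν = 0.013 → 0.005`
while the fat shear datum collapses to the O(1) state — in contrast with `f_GP`, whose Beltrami ray
carries a resolved fat branch (§N1) and is dead as a witness.

ENEMY LOCALISATION (free, from the shell energy inequality (1.31)): call a state `u ∈ H` FED at
viscosity `ν` when it has finite enstrophy and dissipates no more than the force injects,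
`ν‖∇u‖² ≤ (u, f)`. On every half-infinite energy shell `{a ≤ |u|}` the integrand of (1.31) is `> 0` at
every non-fed (STARVED) state, so a stationary statistical solution that charges no fed state of the
shell charges no state of the shell at all (`stub_starvedRide`, provable now). Every steady state is fed;
every laminar/condensate/anchor enemy is fed; genuinely turbulent states above the saturation energy are
starved (they dissipate `~U³` against an injection `≤ ‖f‖U`). So the crux for `f₁₂₃` is EXACTLY the
exclusion of FAT FED states from the support of stationary statistics, and the line cuts that by
blow-down regime:

* `stub_fedHotExclusion` (the card's first rung `DetunedCyclicHotExclusion`, fed form; LOAD-BEARING for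
  the idea): at the Grashof scale `|u| ≥ θ/ν` no stationary statistical solution of `NS_ν(f₁₂₃)` charges
  a fed state, `ν < ν₀(θ)`. Blow-downs `v = νu` of such mass are FORCED-RESONANT Euler-stationary
  measures (`E‖∇v‖² ≤ E(f,v)`, hence visible: `(f,v) ≥ 4π²θ²`), i.e. aligned with the cone of the three
  laminar rays; the lever is the sweep test / lift-up at each face of the cone (second-order Liouville
  identities with the partner coordinates — a dynamical statement, not a moment computation:
  TRIAGE-r1-3).
* `stub_fedWarmExclusion` (HARDEST; the honest sub-Grashof rung): for some `θ₀ > 0` and `R₀`, no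
  stationary statistical solution charges a fed state with `R₀ ≤ |u| < θ₀/ν`. Blow-downs at these
  scales are UNFORCED Euler-stationary measures (`f/A² → 0`): the enemies are quiet anchors / condensates
  (`u ≈ A·V`, `V` steady Euler with `(f,V) = 0`, fed through an `O(1)` halo: the warm ends
  `‖u‖ ≍ ν^{-1/3}` of the `f_GP` census) and rough fed states; the bet (card, BARRIERS) is that every
  anchor of `f₁₂₃` is a linearly polarised shear with an unswept crossing partner, so `f₁₂₃` is not
  solvable over it even with halo stresses, and that cyclic tilting destroys the streak coherence
  self-sustained (VWI/ECS) fat states need. No lever of any round-1 card reaches the rough-fed residue;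
  it is named here, not hidden.
* `stub_starvedRide` (provable now, M): starved states ride on fed ones, shell by shell (any smooth `f`).

Composition: `ceilingAt_f123_of_stubs` (hypothesis form, sorry-free, pure logic) and the skeleton theorem
`EnsembleCeiling_of : EnsembleCeiling` (applies it to the three stubs); admissibility of `f₁₂₃` is PROVED here
(`isSmooth_modes`, `isDivFree_modes`, `hasZeroMean_modes`, `‖f₁₂₃‖₂² = 3/2`); with `a = max R₀ 1`,
`{a ≤ |u|, fed} ⊆ {R₀ ≤ |u| < θ₀/ν, fed} ∪ {θ₀/ν ≤ |u|, fed}` is null by the two exclusions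
(`ν < min ν₀ ν₀(θ₀)`), `stub_starvedRide` makes `{a ≤ |u|}` null, so `|u| < a` a.s. and
`ensembleEnergy μ ≤ a²`: the crux with `E = (max R₀ 1)²`.

## Disproof used (Cruxes/EnsembleCeiling/Disproof.lean, rev 2)

* `ensembleCeiling_false_without_liouville` (any proof must use the Liouville equation (1.30)): honoured —
  `stub_starvedRide` uses only (1.29)+(1.31) and proves NOTHING about fed states; both exclusion stubs are
  statements that are FALSE for the Liouville-free class (the ray states `δ_{Tf}` of `fat_without_liouville`
  are fed and fat), so their proofs must use (1.30) — "the line uses Liouville at `stub_fedHotExclusion`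
  and `stub_fedWarmExclusion`".
* `ensembleCeiling_iff_withoutIntegrable` (integrability is decoration): the composition ignores the
  hypothesis except to feed `integral_mono_ae`.
* (b) tightness `ensembleEnergy_le_support_bound` / `support_bound_attained`: nothing here sees `f` through
  `‖f‖₂` only — every stub is about the geometry of `f₁₂₃`.
* (c) dead classes: `screen_not_orthogonalClass` (`k₂·z₁ ≠ 0`, vs `not_ceilingAt_orthogonalClass` and
  `not_ceilingAt_singleMode`), `screen_threeShells` (shell radii 1, 4, 9 pairwise distinct, vs
  `not_ceilingAt_singleShell_eulerSteady` / `not_ceilingAt_abc` / `not_ceilingAt_cellular`); the Stokes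
  state `A⁻¹f₁₂₃` is not Euler-steady (card + TRIAGE-r1-2: `(f·∇)f` has a curl), so `f₁₂₃` is outside the
  Kishimoto–Yoneda exact-branch classes of `resists` §3.
* (d) no Targets yet; (e) `resists` §2: for `f₁₂₃` (finitely many modes) finite-dimensional fat statistics
  are NOT excluded by §2 — the Galerkin screen of TRIAGE-r1-1 is the relevant evidence instead.

## Triage answers (one line each; details in Lines/sweep-test-cyclic-tlf-witness.md)

r1-1: witness pinned in every stub (no `∃ f` inside a stub); resolved-branch kill rule did not fire
(j013457 K=5: `|u| = 0.99 → 0.75`, ν = 0.01 → 0.005). r1-2: the exact fat 2-mode trap of `f₁+f₃` is the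
named enemy of `stub_fedHotExclusion` (it is fed and hot; the stub bets mode 2 frustrates it); support
form kept knowingly (stronger cousin of the crux; `stub_starvedRide` shows the fed-support form is what
(1.31) reduces everything to). r1-3: the hot rung is graded L+/open and dynamical (moment/Lamb levers
void for a Kolmogorov gravest mode) — recorded in the stub docstring; warm-end risk carried as its own
stub.
-/

noncomputable section

set_option linter.dupNamespace false

namespace Summit.AnomalousDissipation.AnomalousDissipation.Cruxes.EnsembleCeiling.SweepTestCyclicTlfWitness

open MeasureTheory UnitAddTorus Matrix
open scoped InnerProductSpace ENNReal ComplexConjugate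
open Literature.Analysis.FunctionSpaces Literature.Analysis.FluidPDE
open Summit.AnomalousDissipation.AnomalousDissipation.Theses.TaylorCertificates
open Summit.AnomalousDissipation.AnomalousDissipation.Theorems.TaylorCertificatePair.Negative
open Summit.AnomalousDissipation.AnomalousDissipation.Theorems.EnsembleCeiling.Negative

/-- Local notation: real vector fields on `T³`. -/
local notation "Vec3" => ((UnitAddTorus (Fin 3)) → (EuclideanSpace ℝ (Fin 3)))
/-- Local notation: `L²(T³; ℝ³)`. -/
local notation "L2" => (Lp (EuclideanSpace ℝ (Fin 3)) 2 (volume : Measure (UnitAddTorus (Fin 3))))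
/-- Local notation: the energy space `H`. -/
local notation "H3" => (Torus.energySpace (Fin 3))

/-- Local notation: the frequencies `e₃, 2e₁, 3e₂` of the detuned cyclic force. -/
local notation "K₁₂₃" => (![![0, 0, 1], ![2, 0, 0], ![0, 3, 0]] : Fin 3 → (Fin 3 → ℤ))
/-- Local notation: the amplitudes `-i e₁, -i e₂, -i e₃` (so that `Re(e_k z) = sin(2πk·x) eⱼ`). -/
local notation "Z₁₂₃" => (![(WithLp.toLp 2 ![-Complex.I, 0, 0] : EuclideanSpace ℂ (Fin 3)), (WithLp.toLp 2 ![0, -Complex.I, 0] : EuclideanSpace ℂ (Fin 3)), (WithLp.toLp 2 ![0, 0, -Complex.I] : EuclideanSpace ℂ (Fin 3))] : Fin 3 → EuclideanSpace ℂ (Fin 3))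
/-- Local notation: THE WITNESS, the detuned cyclic force `f₁₂₃ = (sin 2πx₃, sin 4πx₁, sin 6πx₂)` as the
tree's mode sum `∑ₘ Re(e_{kₘ} zₘ)` (`Torus.realTrigPoly`, the vocabulary of the Disproof's dead classes). -/
local notation "f₁₂₃" => (∑ mm, Torus.realTrigPoly {K₁₂₃ mm} (fun _ => Z₁₂₃ mm))
/-- Local notation: `u ∈ H` is FED by the force `f` at viscosity `ν` — finite enstrophy and dissipation
not exceeding injection, `ν‖∇u‖² ≤ (u, f)` (spectral `Torus.eGradNormSq`, pairing `Torus.pairing`). The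
complement (STARVED states) is where the integrand of FMRT's shell inequality (1.31) is positive. -/
local notation "FedBy(" ν ", " f ", " u ")" =>
  (Torus.eGradNormSq (((u : H3) : L2) : Vec3) ≠ ⊤ ∧
    ν * ENNReal.toReal (Torus.eGradNormSq (((u : H3) : L2) : Vec3)) ≤ Torus.pairing ((u : H3) : L2) f)

/-! ## The witness is admissible (PROVED) and passes the Disproof's screens -/

/-- The three frequencies are nonzero. -/
theorem f123_freq_ne_zero : ∀ m, K₁₂₃ m ≠ 0 := by decide

/-- The frequencies are in normal form (pairwise distinct and non-opposite). -/
theorem f123_normalForm : ∀ m m' : Fin 3, m ≠ m' → K₁₂₃ m ≠ K₁₂₃ m' ∧ K₁₂₃ m ≠ -K₁₂₃ m' := by decide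

/-- The amplitudes are transversal (`kₘ · zₘ = 0`): `f₁₂₃` is divergence free. -/
theorem f123_transversal : ∀ m, ((fun j => ((K₁₂₃ m) j : ℂ)) ⬝ᵥ (WithLp.ofLp (Z₁₂₃ m))) = 0 := by
  intro m
  fin_cases m <;>
    simp [dotProduct, Fin.sum_univ_three, Matrix.cons_val_zero, Matrix.cons_val_one, Matrix.cons_val_two,
      Matrix.head_cons, Matrix.tail_cons]

/-- `f₁₂₃` is smooth, divergence free and mean zero. -/
theorem f123_smooth_divFree_zeroMean :
    Torus.IsSmooth f₁₂₃ ∧ Torus.IsDivFree f₁₂₃ ∧ Torus.HasZeroMean f₁₂₃ :=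
  ⟨isSmooth_modes _ _, isDivFree_modes _ _ f123_transversal, hasZeroMean_modes _ _ f123_freq_ne_zero⟩

/-- Energy of the witness: `∫ ‖f₁₂₃‖² = 3/2`. -/
theorem f123_integral_norm_sq : ∫ x, ‖f₁₂₃ x‖ ^ 2 = 3 / 2 := by
  rw [integral_norm_sq_modes_of_normalForm f123_freq_ne_zero f123_normalForm]
  simp only [Fin.sum_univ_three, Matrix.cons_val_zero, Matrix.cons_val_one, Matrix.cons_val_two,
    Matrix.head_cons, Matrix.tail_cons, EuclideanSpace.norm_eq]
  simp [Complex.norm_I]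
  norm_num

/-- The witness is nonzero in `L²` (the crux's honesty clause `0 < ‖f‖₂²`). -/
theorem f123_integral_norm_sq_pos : 0 < ∫ x, ‖f₁₂₃ x‖ ^ 2 := by
  rw [f123_integral_norm_sq]; norm_num

/-- SCREEN vs `Negative/OrthogonalClassFat` + `SingleModeFat`: `f₁₂₃` is NOT in the orthogonal class —
the wavevector `k₂ = 2e₁` of the second mode is not orthogonal to the amplitude `z₁ = -i e₁` of the first
(`k₂ · z₁ = -2i`). -/
theorem screen_not_orthogonalClass : ((fun j => ((K₁₂₃ 1) j : ℂ)) ⬝ᵥ (WithLp.ofLp (Z₁₂₃ 0))) ≠ 0 := by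
  simp [dotProduct, Fin.sum_univ_three, Matrix.cons_val_zero, Matrix.cons_val_one, Matrix.cons_val_two,
    Matrix.head_cons, Matrix.tail_cons, Complex.ext_iff]

/-- SCREEN vs `Negative/BeltramiFat` + `CellularFat`: `f₁₂₃` lives on THREE Stokes shells
(`|k₁|² = 1`, `|k₂|² = 4`, `|k₃|² = 9`), so it is not a single-shell (Beltrami / ABC / cellular) force. -/
theorem screen_threeShells :
    Torus.freqNormSq (K₁₂₃ 0) = 1 ∧ Torus.freqNormSq (K₁₂₃ 1) = 4 ∧ Torus.freqNormSq (K₁₂₃ 2) = 9 := by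
  refine ⟨?_, ?_, ?_⟩ <;> simp [Torus.freqNormSq, Fin.sum_univ_three] <;> norm_num

/-! ## The stubs -/

/-- **`stub_fedHotExclusion`** — THE HOT RUNG, fed form (the card's first lemma
`DetunedCyclicHotExclusion`; LOAD-BEARING for the idea; size L+, open). For every `θ > 0` there is
`ν₀(θ) > 0` such that for `0 < ν < ν₀` NO stationary statistical solution of `NS_ν(f₁₂₃)` charges a FED
state of the Grashof-scale region `|u| ≥ θ/ν`. Equivalent, given `stub_starvedRide`, to the card's
all-states form `μ{θ/ν ≤ |u|} = 0`. WHY PLAUSIBLY TRUE: push `μ` forward by `u ↦ νu`; hot fed mass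
becomes mass of a forced-resonant Euler-stationary measure (`E‖∇v‖² ≤ E(f,v)`, Euler–Liouville up to an
explicit `O(ν²)`), carried by states whose three forced amplitudes are at laminar level (the cone over
the rays `sin 2πx₃ e₁/4π²`, `sin 4πx₁ e₂/16π²`, `sin 6πx₂ e₃/36π²`); every face of that cone is a
linearly polarised shear configuration with an UNSWEPT CROSSING partner among the other two modes
(TLF bookkeeping, checked by TRIAGE-r1-2/3), whose Stokes-size response is lifted up to streaks
`~ν⁻³ ≫` the support bound — e.g. the exact fat trap `(U(y,z), 0, sin 6πy/(36π²ν))` of the sub-force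
`f₁+f₃` is destroyed by mode 2 (`w₂ ≍ ν^{-1/2}`, streak forcing `w₂R′ ≍ ν^{-3/2}`); two fat components
tilt each other exactly (`(U(z−R(y)t),0,R(y))` solves Euler), converting aligned energy into enstrophy
`∝ t²`. The proof must be DYNAMICAL (second-order Liouville identities with the partner coordinates
`(u, ĝ_{k'})` at the right `ν`-scaling): first-order / moment identities are passed by ray-hugging states
with correlated `(u₂,u₃)` stress (TRIAGE-r1-3), and it must use (1.30) (`fat_without_liouville`).
ENEMIES: a hot steady or recurrent fed state of `NS_ν(f₁₂₃)` — none in resolved truncations K = 4, 5 down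
to ν = 0.005 (TRIAGE-r1-1 §N2). LEANS ON: `Torus.IsStationaryStatisticalSolution` (generator, energy_ineq,
ae_norm_le), `FrustratedForces.RescaledSkeletonSSS`/`LaminarLimitCompactness` (unproved, provable now),
`Torus.EnergySpaceRellich`; lift-up/Orr: Ellingsen–Palm 1975, arXiv:1506.03720, arXiv:1711.01822. -/
theorem stub_fedHotExclusion :
    ∀ θ : ℝ, 0 < θ → ∃ ν₀ : ℝ, 0 < ν₀ ∧ ∀ ν : ℝ, 0 < ν → ν < ν₀ →
      ∀ μ : Measure H3, Torus.IsStationaryStatisticalSolution ν f₁₂₃ μ →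
        μ {u : H3 | θ / ν ≤ ‖u‖ ∧ FedBy(ν, f₁₂₃, u)} = 0 := by
  sorry

/-- **`stub_fedWarmExclusion`** — THE WARM RUNG, fed form (HARDEST; open-problem grade). For some
`θ₀ > 0`, `R₀` and `ν₀ > 0`: for `0 < ν < ν₀` NO stationary statistical solution of `NS_ν(f₁₂₃)` charges
a FED state of the sub-Grashof window `R₀ ≤ |u| < θ₀/ν`. WHY PLAUSIBLY TRUE / WHAT IT TAKES: a fed fat
state at amplitude `A ∈ [R₀, θ₀/ν)` injects `≤ ‖f‖A` yet is fat, so its blow-down `u/A` (Navier–Stokes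
with viscosity `ν/A → 0` AND force `f/A² → 0`) is an UNFORCED Euler-stationary measure in the limit:
the enemies are (i) QUIET ANCHORS / CONDENSATES `u ≈ A·V`, `V` steady Euler with `(f,V) = 0`, fed through
an `O(1)` halo `w` (production `∫ w⊗w : ∇V = νA‖∇V‖²`; the warm ends `‖u‖ ≍ ν^{-1/3}` of the `f_GP`
Galerkin census j001684/j001712/j001732 are of this type), and (ii) ROUGH fed states (Taylor-scale
halos, self-sustained VWI/ECS states: Waleffe 1997, HallSherwin2010, LucasKerswell2017). The card's bet
for `f₁₂₃`: every anchor is a linearly polarised single-wavevector shear with an unswept crossing partner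
(no multi-mode Euler-steady sub-response: `(f·∇)f` has a curl; no separable steady state; Beltrami and
circular anchors lose their unforced components at rate O(1) against O(ν^{4/3}) stress feedback), so
`f₁₂₃` is not solvable over any anchor even with halo stresses once the halo's own lift-up is priced,
and cyclic tilting denies (ii) the streak coherence it needs. HONEST GAP: no round-1 lever touches (ii)
rigorously; a second-order corrector law (TRIAGE-r1-1 on quiet-fat-blowup-hierarchy) is the missing tool.
Must use (1.30). ENEMIES: any steady / recurrent fed state of `NS_ν(f₁₂₃)` with `1 ≪ |u| ≪ 1/ν` along
`ν → 0` (a warm branch `|u| ≍ ν^{-a}`, `0 < a < 1`, of the Stokes-connected family would kill it: not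
seen down to ν = 0.005, TRIAGE-r1-1 §N2, `|u|` DEcreasing 0.99 → 0.75). LEANS ON: as the hot stub, plus
`quiet-fat-blowup-hierarchy`'s `ScalingCovariance`/`QuietFatLimit` (SketchIdeator2, unproved),
`Literature.Analysis.FluidPDE.KishimotoYoneda2022_finiteMode_rigidity` (finite-mode anchors are planar or
single-shell Beltrami), Haberman 1972 (nonlinear critical layers). -/
theorem stub_fedWarmExclusion :
    ∃ θ₀ : ℝ, 0 < θ₀ ∧ ∃ (R₀ ν₀ : ℝ), 0 < ν₀ ∧ ∀ ν : ℝ, 0 < ν → ν < ν₀ →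
      ∀ μ : Measure H3, Torus.IsStationaryStatisticalSolution ν f₁₂₃ μ →
        μ {u : H3 | R₀ ≤ ‖u‖ ∧ ‖u‖ < θ₀ / ν ∧ FedBy(ν, f₁₂₃, u)} = 0 := by
  sorry

/-- **`stub_starvedRide`** — STARVED STATES RIDE ON FED ONES, SHELL BY SHELL (provable now, size M; the
energetic half of the line, valid for EVERY smooth force). For `ν > 0`, smooth `f`, a stationary
statistical solution `μ` of `NS_ν(f)` and `a > 0`: if `μ` charges no FED state of the half-infinite
shell `{a ≤ |u|}`, it charges no state of that shell. WHY TRUE: `μ`-a.e. state has finite enstrophy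
(`IsStationaryStatisticalSolution.ae_eGradNormSq_lt_top`, (1.29)); by hypothesis a.e. state of the shell
is starved, `ν‖∇u‖² > (u,f)`, i.e. the integrand `I(u) = ν‖∇u‖² − (u,f)` of the shell inequality is
`> 0` a.e. on the shell; but (1.31) with `e₁ = ENNReal.ofReal (a²)`, `e₂ = ⊤`
(`IsStationaryStatisticalSolution.energy_ineq`; the shell `{e₁ ≤ ‖u‖ₑ² < ⊤}` is `{a ≤ |u|}` for
`a > 0`) gives `∫_{a ≤ |u|} I dμ ≤ 0` with `I` integrable (`integrable_toReal_eGradNormSq`,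
`integrable_pairing`), so `I = 0` a.e. on the shell (`setIntegral_nonpos`/`ae_nonneg` bookkeeping), hence
the shell is null. No Liouville equation is used — consistent with `fat_without_liouville`: this stub says
nothing about fed states. LEANS ON: `StatisticalSolutionEnergyEq.lean` (the four lemmas named),
`MeasureTheory.setIntegral_pos_iff_support_of_nonneg_ae` / `integral_eq_zero_iff_of_nonneg_ae`. -/
theorem stub_starvedRide :
    ∀ ν : ℝ, 0 < ν → ∀ f : Vec3, Torus.IsSmooth f →
      ∀ μ : Measure H3, Torus.IsStationaryStatisticalSolution ν f μ →
        ∀ a : ℝ, 0 < a → μ {u : H3 | a ≤ ‖u‖ ∧ FedBy(ν, f, u)} = 0 → μ {u : H3 | a ≤ ‖u‖} = 0 := by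
  sorry

/-! ## The composition (kernel-checked, no sorry) -/

/-- **Composition, hypothesis form** (pure logic + measure theory, sorry-free, uses NO stub): the three stub
STATEMENTS give the ceiling AT THE WITNESS `f₁₂₃` with `E = (max R₀ 1)²`: below `min ν₀ ν₀(θ₀)` the fed
part of the tail `{max R₀ 1 ≤ |u|}` is covered by the warm window and the hot region, both null; the
ride hypothesis nulls the whole tail; so `|u|² ≤ (max R₀ 1)²` a.s. and the mean energy obeys the same bound
(`integral_mono_ae`; `μ` is a probability measure by `IsStationaryStatisticalSolution.prob`). -/
theorem ceilingAt_f123_of_stubs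
    (hHot : ∀ θ : ℝ, 0 < θ → ∃ ν₀ : ℝ, 0 < ν₀ ∧ ∀ ν : ℝ, 0 < ν → ν < ν₀ →
      ∀ μ : Measure H3, Torus.IsStationaryStatisticalSolution ν f₁₂₃ μ →
        μ {u : H3 | θ / ν ≤ ‖u‖ ∧ FedBy(ν, f₁₂₃, u)} = 0)
    (hWarm : ∃ θ₀ : ℝ, 0 < θ₀ ∧ ∃ (R₀ ν₀ : ℝ), 0 < ν₀ ∧ ∀ ν : ℝ, 0 < ν → ν < ν₀ →
      ∀ μ : Measure H3, Torus.IsStationaryStatisticalSolution ν f₁₂₃ μ →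
        μ {u : H3 | R₀ ≤ ‖u‖ ∧ ‖u‖ < θ₀ / ν ∧ FedBy(ν, f₁₂₃, u)} = 0)
    (hRide : ∀ ν : ℝ, 0 < ν → ∀ f : Vec3, Torus.IsSmooth f →
      ∀ μ : Measure H3, Torus.IsStationaryStatisticalSolution ν f μ →
        ∀ a : ℝ, 0 < a → μ {u : H3 | a ≤ ‖u‖ ∧ FedBy(ν, f, u)} = 0 → μ {u : H3 | a ≤ ‖u‖} = 0) :
    ∃ (E ν₀ : ℝ), 0 < ν₀ ∧ ∀ ν : ℝ, 0 < ν → ν < ν₀ →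
      ∀ μ : Measure H3, Torus.IsStationaryStatisticalSolution ν f₁₂₃ μ →
        Integrable (fun v : H3 => ‖v‖ ^ 2) μ → Torus.ensembleEnergy μ ≤ E := by
  obtain ⟨θ₀, hθ₀, R₀, ν₁, hν₁, hW⟩ := hWarm
  obtain ⟨ν₂, hν₂, hH⟩ := hHot θ₀ hθ₀
  have hfs : Torus.IsSmooth f₁₂₃ := f123_smooth_divFree_zeroMean.1
  refine ⟨(max R₀ 1) ^ 2, min ν₁ ν₂, lt_min hν₁ hν₂, ?_⟩
  intro ν hν hνlt μ hμ hint
  have hν1 : ν < ν₁ := lt_of_lt_of_le hνlt (min_le_left _ _)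
  have hν2 : ν < ν₂ := lt_of_lt_of_le hνlt (min_le_right _ _)
  have ha : (0 : ℝ) < max R₀ 1 := lt_of_lt_of_le one_pos (le_max_right _ _)
  -- the fed part of the tail is covered by the warm window and the hot region
  have hsub : {u : H3 | max R₀ 1 ≤ ‖u‖ ∧ FedBy(ν, f₁₂₃, u)} ⊆
      {u : H3 | R₀ ≤ ‖u‖ ∧ ‖u‖ < θ₀ / ν ∧ FedBy(ν, f₁₂₃, u)} ∪
        {u : H3 | θ₀ / ν ≤ ‖u‖ ∧ FedBy(ν, f₁₂₃, u)} := by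
    rintro u ⟨hau, hfu⟩
    by_cases hlt : ‖u‖ < θ₀ / ν
    · exact Or.inl ⟨le_trans (le_max_left _ _) hau, hlt, hfu⟩
    · exact Or.inr ⟨not_lt.1 hlt, hfu⟩
  have hfed : μ {u : H3 | max R₀ 1 ≤ ‖u‖ ∧ FedBy(ν, f₁₂₃, u)} = 0 :=
    measure_mono_null hsub (measure_union_null (hW ν hν hν1 μ hμ) (hH ν hν hν2 μ hμ))
  -- starved states ride on fed ones: the whole tail is null
  have htail : μ {u : H3 | max R₀ 1 ≤ ‖u‖} = 0 := hRide ν hν _ hfs μ hμ (max R₀ 1) ha hfed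
  have hae : ∀ᵐ u ∂μ, ‖u‖ ^ 2 ≤ (max R₀ 1) ^ 2 := by
    filter_upwards [measure_eq_zero_iff_ae_notMem.1 htail] with u hu
    simp only [not_le] at hu
    exact pow_le_pow_left₀ (norm_nonneg _) hu.le 2
  haveI := hμ.prob
  unfold Torus.ensembleEnergy
  calc ∫ u, ‖u‖ ^ 2 ∂μ ≤ ∫ _u, (max R₀ 1) ^ 2 ∂μ := integral_mono_ae hint (integrable_const _) hae
    _ = (max R₀ 1) ^ 2 := by simp

/-- **`EnsembleCeiling_of`** — THE SKELETON THEOREM: the crux `TaylorCertificates.EnsembleCeiling` BY NAME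
from the three registered stubs (its only `sorry`s are inside `stub_fedHotExclusion`,
`stub_fedWarmExclusion`, `stub_starvedRide`), with the witness `f₁₂₃` whose admissibility
(`f123_smooth_divFree_zeroMean`, `f123_integral_norm_sq_pos`) is PROVED in this file. -/
theorem EnsembleCeiling_of :
    Summit.AnomalousDissipation.AnomalousDissipation.Theses.TaylorCertificates.EnsembleCeiling := by
  obtain ⟨hfs, hfd, hfz⟩ := f123_smooth_divFree_zeroMean
  obtain ⟨E, ν₀, hν₀, h⟩ :=
    ceilingAt_f123_of_stubs stub_fedHotExclusion stub_fedWarmExclusion stub_starvedRide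
  exact ⟨_, hfs, hfd, hfz, f123_integral_norm_sq_pos, E, ν₀, hν₀, h⟩

end Summit.AnomalousDissipation.AnomalousDissipation.Cruxes.EnsembleCeiling.SweepTestCyclicTlfWitness
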